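import Summits.Ventures.PercRepro.RankLevelSetDepCountGen
import Summits.Ventures.PercRepro.RankLevelSetLevelFive
import Summits.Ventures.PercRepro.RankLevelSetDepCountGiantB2
import Summits.Ventures.PercRepro.RankLevelSetLevelFiveGiant
import Summits.Ventures.PercRepro.RankLevelSetLevelSplitAll
import Summits.Ventures.PercRepro.S1TriangleCount
import Summits.Ventures.PercRepro.S1FourCircuitCount
import Summits.Ventures.PercRepro.RankLevelSetPlaneTenPrime
import Summits.Ventures.PercRepro.RankLevelSetCorankFiveCounts
import Summits.Ventures.PercRepro.S2FlatTail
import Summits.Ventures.PercRepro.S2SetCountQ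
import Summits.Ventures.PercRepro.S2SharpCoreXQ
import Summits.Ventures.PercRepro.S2SharpTopXQI
import Summits.Ventures.PercRepro.S1TrianglePlusSharp
import Summits.Ventures.PercRepro.S1CoreFourCircuitSum

/-!
# PercRepro — S2: THE LEVEL-`5` CORE FROM ONE CELL — T⁺⁺⁺ / T4⁺, THE SET-BASED GIANT TERM, THE RANK-`4` TAIL BY THE SET-INDEXED COUNT, AND THE INDEPENDENT `5`-SETS CORRECTED BY THE TRIANGLES (p7, gen 4; sub-claim S2; the cell `(21, 7)`)

S2SharpCoreXQ's core `c025_core_five_sharp_cell_xq` with ONE more lever on the polynomial side: the `5`-element rank-`5`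
sets (the independent `5`-sets) are counted by S2SetCountQI's partition count EXACTLY, and bounded through the triangles
(S2IndepFiveCount: `#{independent 5-sets} ≤ C(n, 5) − s₃·C(n − 3, 2) + C(s₃, 2)`); since `s₃ ≤ T := (d² − 3d + 6)/2` (T⁺⁺⁺)
and the polynomial side is increasing in `s₃` (`σ_m·C(n − 3, 3) ≥ C(n − 3, 2)` once `n ≥ 8`), the cell's polynomial side reads
`1024·(C(n, 5) − T·C(n − 3, 2) + C(T, 2) + σ_m·(…) + (σ_g − σ_m)·C(F_max, 6)) ≤ (1024 − m)·2^(d−5)·C(p + 5, 5)`;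
the tail side is S2SharpCoreXQ's, unchanged: **`c025_core_five_sharp_cell_xqi`**. At `(21, 7)` the correction is worth
`≥ 4,964` of the `263,120` units of the denominator against an excess of `≈ 3,900`: the cell closes (S2CellsP21XQI).
Axioms: standard.
-/

open scoped Matroid

namespace PercRepro

namespace ThmN

open Set

variable {α : Type}

/-- **The `e`-free core at level `5`, corank `d ≥ 6`, any rank `p`, from one cell with the sharpened pair counts**
(the «31» / «30» chain's matroid part with `S2SharpPairs`' counts `C(n − k, q + 1 − k)` / `C(F_max − k, q + 1 − k)`; the
cell `(p, d)` — polynomial side and tail side with a free slack `m/1024` — is the hypothesis `hcell`). -/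
theorem c025_core_five_sharp_cell_xqi (M : Matroid α) [M.Finite] (p d : ℕ) (hd6 : 6 ≤ d) (hp5 : 5 ≤ p)
    (hR : M.eRank = (p : ℕ∞)) (hn : M.E.ncard = p + d)
    (hfree : ∀ e ∈ M.E, ∃ A ⊆ M.E \ {e}, e ∉ M.closure A ∧ e ∉ M.closure ((M.E \ {e}) \ A))
    (hcell : ∃ m : ℕ, m ≤ 1024 ∧
      (1024 * ((((p + d).choose 5 : ℚ) - (((d * d + 6 - 3 * d) / 2 : ℕ) : ℚ) * ((p + d - 3).choose 2 : ℚ) +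
        ((((d * d + 6 - 3 * d) / 2).choose 2 : ℕ) : ℚ)) +
      (∑ j ∈ Finset.range (d - 5), (Nat.choose (min 13 ((d + 6) / 2 + 1 - 2)) j : ℚ) / (((j + 1) + 3 * (j + 1).choose 2 : ℕ) : ℚ)) *
        ((((d * d + 6 - 3 * d) / 2) * (p + d - 3).choose 3 + S1.fourCircuitBound d * (p + d - 4).choose 2 + (d + 4).choose 5 * (p + d - 5) + (d + 5).choose 6 : ℕ) : ℚ) +
      ((∑ j ∈ Finset.range (d - 5), (Nat.choose (min 19 (5 + d) - 6) j : ℚ) / (((j + 1) + 3 * (j + 1).choose 2 : ℕ) : ℚ)) -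
        (∑ j ∈ Finset.range (d - 5), (Nat.choose (min 13 ((d + 6) / 2 + 1 - 2)) j : ℚ) / (((j + 1) + 3 * (j + 1).choose 2 : ℕ) : ℚ))) *
        ((min 19 (5 + d)).choose 6 : ℚ)) ≤
        ((1024 - m : ℕ) : ℚ) * 2 ^ (d - 5) * ((p + 5).choose 5 : ℚ)) ∧
      (1024 * ((((p + d).choose 4 : ℚ) +
      (∑ j ∈ Finset.range 6, (Nat.choose (min 5 ((d + 3) / 2 + 1 - 2)) j : ℚ) / (((j + 1) + 3 * (j + 1).choose 2 : ℕ) : ℚ)) *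
        ((((d * d + 6 - 3 * d) / 2) * (p + d - 3).choose 2 + S1.fourCircuitBound d * (p + d - 4) + (d + 4).choose 5 : ℕ) : ℚ) +
      ((∑ j ∈ Finset.range 6, (Nat.choose 5 j : ℚ) / (((j + 1) + 3 * (j + 1).choose 2 : ℕ) : ℚ)) -
        (∑ j ∈ Finset.range 6, (Nat.choose (min 5 ((d + 3) / 2 + 1 - 2)) j : ℚ) / (((j + 1) + 3 * (j + 1).choose 2 : ℕ) : ℚ))) *
        ((10 : ℕ).choose 5 : ℚ)) +
      (((p + d).choose 3 * 2 ^ 3 + (p + d).choose 2 * 2 + (p + d) + 1 : ℕ) : ℚ) +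
      (((p + d).choose 5 : ℚ) + (∑ j ∈ Finset.range (d), (Nat.choose (min 13 ((d + 6) / 2 + 1 - 2)) j : ℚ) / (((j + 1) + 3 * (j + 1).choose 2 : ℕ) : ℚ)) * ((((d * d + 6 - 3 * d) / 2) * (p + d - 3).choose 3 + S1.fourCircuitBound d * (p + d - 4).choose 2 + (d + 4).choose 5 * (p + d - 5) + (d + 5).choose 6 : ℕ) : ℚ) +
        ((∑ j ∈ Finset.range (d), (Nat.choose (min 19 (5 + d) - 6) j : ℚ) / (((j + 1) + 3 * (j + 1).choose 2 : ℕ) : ℚ)) - (∑ j ∈ Finset.range (d), (Nat.choose (min 13 ((d + 6) / 2 + 1 - 2)) j : ℚ) / (((j + 1) + 3 * (j + 1).choose 2 : ℕ) : ℚ))) *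
        ((min 19 (5 + d)).choose 6 : ℚ)) +
      ((∑ j ∈ Finset.range (d + 1), (p + d).choose j : ℕ) : ℚ)) ≤ (m : ℚ) * 2 ^ (p + d))) :
    RLS M p 5 := by
  classical
  -- the slack arithmetic (S2Cells29's `level_arith_slack` at `k = 1024`, `q = 5`, `n = p + d`, inlined)
  have hslack : ∀ {Φ U Y A B V : ℚ} {m : ℕ},
      Φ ≤ (2 : ℚ) ^ (p + 5) / ((p + 5).choose 5 : ℚ) → 0 ≤ U → U ≤ V →
      (2 : ℚ) ^ (p + d) ≤ Y + A + B → m ≤ 1024 → (1024 : ℚ) * (A + B) ≤ (m : ℚ) * 2 ^ (p + d) →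
      (1024 : ℚ) * V ≤ ((1024 - m : ℕ) : ℚ) * 2 ^ (d - 5) * ((p + 5).choose 5 : ℚ) →
      Φ * U ≤ Y := by
    intro Φ U Y A B V m hΦ hU0 hU hY hmk hAB hpoly
    have hc : (0 : ℚ) < ((p + 5).choose 5 : ℚ) := by exact_mod_cast Nat.choose_pos (by omega)
    have hkq : (0 : ℚ) < (1024 : ℚ) := by norm_num
    have hkm : ((1024 - m : ℕ) : ℚ) = (1024 : ℚ) - (m : ℚ) := by
      rw [Nat.cast_sub hmk]; norm_num
    have hpow : (2 : ℚ) ^ (p + d) = 2 ^ (p + 5) * 2 ^ (d - 5) := by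
      rw [← pow_add]; congr 1; omega
    have h1 : Φ * U ≤ (2 : ℚ) ^ (p + 5) / ((p + 5).choose 5 : ℚ) * U := mul_le_mul_of_nonneg_right hΦ hU0
    have h2 : (2 : ℚ) ^ (p + 5) / ((p + 5).choose 5 : ℚ) * U ≤
        (2 : ℚ) ^ (p + 5) / ((p + 5).choose 5 : ℚ) * V :=
      mul_le_mul_of_nonneg_left hU (by positivity)
    have h3 : (2 : ℚ) ^ (p + 5) / ((p + 5).choose 5 : ℚ) * V ≤
        ((1024 : ℚ) - m) / 1024 * 2 ^ (p + d) := by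
      rw [hpow, div_mul_eq_mul_div, div_le_iff₀ hc]
      have h2p : (0 : ℚ) < 2 ^ (p + 5) := by positivity
      have hpoly' : V ≤
          ((1024 : ℚ) - m) / 1024 * 2 ^ (d - 5) * ((p + 5).choose 5 : ℚ) := by
        rw [hkm] at hpoly
        rw [div_mul_eq_mul_div, div_mul_eq_mul_div, div_eq_mul_inv]
        have := mul_le_mul_of_nonneg_right hpoly (le_of_lt (inv_pos.mpr hkq))
        rw [mul_comm (1024 : ℚ), mul_assoc, mul_inv_cancel₀ hkq.ne', mul_one] at this
        linarith
      calc (2 : ℚ) ^ (p + 5) * V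
          ≤ 2 ^ (p + 5) * (((1024 : ℚ) - m) / 1024 * 2 ^ (d - 5) * ((p + 5).choose 5 : ℚ)) :=
            mul_le_mul_of_nonneg_left hpoly' h2p.le
        _ = ((1024 : ℚ) - m) / 1024 * (2 ^ (p + 5) * 2 ^ (d - 5)) * ((p + 5).choose 5 : ℚ) := by ring
    have h4 : ((1024 : ℚ) - m) / 1024 * (2 : ℚ) ^ (p + d) ≤ Y := by
      have hAB' : A + B ≤ (m : ℚ) / 1024 * 2 ^ (p + d) := by
        rw [div_mul_eq_mul_div, le_div_iff₀ hkq]; linarith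
      have : ((1024 : ℚ) - m) / 1024 * (2 : ℚ) ^ (p + d) = 2 ^ (p + d) - (m : ℚ) / 1024 * 2 ^ (p + d) := by
        rw [sub_div, div_self hkq.ne']; ring
      rw [this]; linarith
    linarith
  have hEcard : M.ground_finite.toFinset.card = p + d := by
    rw [← Set.ncard_eq_toFinset_card _ M.ground_finite]; exact hn
  -- the core is simple: every circuit has `≥ 3` elements
  have hL0 : ∀ e ∈ M.E, ¬ M.IsLoop e := not_isLoop_of_free M hfree
  have hs : ∀ e ∈ M.E, ∀ f ∈ M.E, e ≠ f → M.eRk {e, f} = 2 := by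
    intro e he f hf hef
    have h2 : (2 : ℕ∞) ≤ M.eRk {e, f} :=
      two_le_eRk_of_two_le_ncard_of_free M hfree (pair_subset he hf) (by rw [ncard_pair hef])
    have h3 : M.eRk {e, f} ≤ 2 := by
      have := M.eRk_le_encard {e, f}
      rwa [encard_pair hef] at this
    exact le_antisymm h3 h2
  have hcirc : ∀ C, M.IsCircuit C → 3 ≤ C.encard := three_le_encard_of_circuit M hL0 hs
  have hd : M.E.encard = M.eRank + d := by
    rw [hR, ← M.ground_finite.cast_ncard_eq, hn]
    push_cast
    ring
  -- the capped flat bounds: rank-`≤ 5` sets have `≤ min 19 (5 + d)` points, rank-`≤ 4` sets `≤ min 10 (4 + d)`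
  have hflat : ∀ X ⊆ M.E, M.eRk X ≤ 5 → X.ncard ≤ min 19 (5 + d) := fun X hX hr =>
    le_min (ncard_le_nineteen_of_eRk_le_five_of_free M hfree hX hr)
      (ncard_le_add_of_eRk_le_of_encard_eq M hd hX hr)
  have hflat' : ∀ X ⊆ M.E, M.eRk X ≤ ((5 - 1 : ℕ) : ℕ∞) → X.ncard ≤ min 10 (4 + d) := fun X hX hr =>
    le_min (ncard_le_ten_of_eRk_le_four_of_free M hfree hX (by simpa using hr))
      (ncard_le_add_of_eRk_le_of_encard_eq M hd hX (by simpa using hr))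
  -- the circuit counts: Lemma T, Lemma T4, and the nullity bounds
  have hC1 : ∀ L ⊆ M.E, M.eRk L = 2 → L.ncard ≤ 3 :=
    fun L hL hr => ncard_le_three_of_eRk_two M hs hfree hL hr
  have hC2 : ∀ P ⊆ M.E, M.eRk P ≤ 3 → P.ncard ≤ 6 :=
    fun P hP hr => ncard_le_six_of_eRk_le_three_of_free M hfree hP hr
  have hs3 : {C | M.IsCircuit C ∧ C.ncard = 3}.ncard ≤ (d * d + 6 - 3 * d) / 2 := by
    have := S1.ncard_triangles_le_of_nullity_sharp M hC1 hC2 (by omega) hd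
    unfold triangles at this
    exact this
  have hs4 : {C | M.IsCircuit C ∧ C.ncard = 4}.ncard ≤ S1.fourCircuitBound d :=
    S1.ncard_fourCircuits_le_fourCircuitBound M hfree hd
  have hs5 : {C | M.IsCircuit C ∧ C.ncard = 5}.ncard ≤ (d + 4).choose 5 :=
    Matroid.ncard_circuits_le_choose_of_encard M hd 4
  have hs6 : {C | M.IsCircuit C ∧ C.ncard = 6}.ncard ≤ (d + 5).choose 6 :=
    Matroid.ncard_circuits_le_choose_of_encard M hd 5
  -- (U): the square-multiplicity count in the PARTITION form, in `ℚ`, then the circuit bounds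
  set ν₁ : ℕ := (d + 6) / 2 + 1 with hν₁
  have hm1 : min (min 19 (5 + d) - 6) (ν₁ - 2) = min 13 ((d + 6) / 2 + 1 - 2) := by omega
  have hm3 : min (min 19 (5 + d)) (5 + d) = min 19 (5 + d) := by omega
  have hUq := topCount_le_sharp_xqi M p d hd6 hp5 hR hn hfree
  -- (Y): the STRUCTURED flat tail — ranks `≤ 4` through their closures, rank `5` by the level count at `D = 5 + d`
  have hY := Matroid.two_pow_le_midCount_add (M := M) p 5 hR
  have hsum5 := S2.ncard_eRk_le_le_sum M 5
  simp only [Finset.sum_range_succ, Finset.sum_range_zero, zero_add] at hsum5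
  -- the rank-`4` sets by the set-indexed count at level `4` (`D = 10`: every rank-`4` set has `≤ 10` points)
  have h4 : {X : Set α | X ⊆ M.E ∧ M.eRk X = 4}.ncard ≤
      {B : Set α | B ⊆ M.E ∧ M.eRk B = 4 ∧ B.ncard ≤ 10}.ncard := by
    apply Set.ncard_le_ncard
    · intro X hX
      exact ⟨hX.1, hX.2, ncard_le_ten_of_eRk_le_four_of_free M hfree hX.1 (by rw [hX.2])⟩
    · exact M.ground_finite.finite_subsets.subset (fun B hB => hB.1)
  have hinter4 : ∀ X ⊆ M.E, M.eRk X ≤ ((4 - 1 : ℕ) : ℕ∞) → (X.ncard : ℕ∞) ≤ M.eRk X + (3 : ℕ) := by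
    intro X hX hr
    obtain ⟨k, hk⟩ := Matroid.exists_eRk_eq_nat (M := M) hX
    rw [hk] at hr ⊢
    have hk3 : k ≤ 3 := by exact_mod_cast hr
    have hcard : X.ncard ≤ k + 3 := by
      rcases Nat.lt_or_ge k 3 with h | h
      · have := ncard_add_one_le_two_pow_of_eRk_le M hL0 hfree k X hX (le_of_eq hk)
        interval_cases k <;> omega
      · have hk' : k = 3 := by omega
        subst hk'
        have := hC2 X hX (le_of_eq hk)
        omega
    exact_mod_cast hcard
  set ν₄ : ℕ := (d + 3) / 2 + 1 with hν₄
  have hflat4 : ∀ X ⊆ M.E, M.eRk X ≤ 4 → X.ncard ≤ min 10 (4 + d) := fun X hX hr =>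
    hflat' X hX (by simpa using hr)
  have hflat4' : ∀ X ⊆ M.E, M.eRk X ≤ ((4 - 1 : ℕ) : ℕ∞) → X.ncard ≤ 6 := fun X hX hr =>
    hC2 X hX (by simpa using hr)
  have hD4 := S2.ncard_eRk_eq_ncard_le_le_sets M 4 (min 10 (4 + d)) 6 ν₄ 3 10 (by norm_num)
    hcirc hC1 hflat4 hflat4' hinter4 hd (by omega) (by omega) (by omega)
  have hm41 : min (min 10 (4 + d) - 5) (ν₄ - 2) = min 5 ((d + 3) / 2 + 1 - 2) := by omega
  have hm43 : min (min 10 (4 + d)) (4 + d) = 10 := by omega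
  simp only [show (4 : ℕ) + 1 = 5 from rfl] at hD4
  rw [hn, sum_Icc_three_five_q, hm41, hm43, show 10 - 5 + 1 = 6 by norm_num,
    show 10 - 5 = 5 by norm_num] at hD4
  simp only [show (5 : ℕ) - 3 = 2 from rfl, show (5 : ℕ) - 4 = 1 from rfl,
    show (5 : ℕ) - 5 = 0 from rfl, Nat.choose_one_right, Nat.choose_zero_right] at hD4
  have hD4q : ({B : Set α | B ⊆ M.E ∧ M.eRk B = 4 ∧ B.ncard ≤ 10}.ncard : ℚ) ≤ (((p + d).choose 4 : ℚ) +
      (∑ j ∈ Finset.range 6, (Nat.choose (min 5 ((d + 3) / 2 + 1 - 2)) j : ℚ) / (((j + 1) + 3 * (j + 1).choose 2 : ℕ) : ℚ)) *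
        ((((d * d + 6 - 3 * d) / 2) * (p + d - 3).choose 2 + S1.fourCircuitBound d * (p + d - 4) + (d + 4).choose 5 : ℕ) : ℚ) +
      ((∑ j ∈ Finset.range 6, (Nat.choose 5 j : ℚ) / (((j + 1) + 3 * (j + 1).choose 2 : ℕ) : ℚ)) -
        (∑ j ∈ Finset.range 6, (Nat.choose (min 5 ((d + 3) / 2 + 1 - 2)) j : ℚ) / (((j + 1) + 3 * (j + 1).choose 2 : ℕ) : ℚ))) *
        ((10 : ℕ).choose 5 : ℚ)) := by
    have hsm4 : {C | M.IsCircuit C ∧ C.ncard = 3}.ncard * (p + d - 3).choose 2 +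
        {C | M.IsCircuit C ∧ C.ncard = 4}.ncard * (p + d - 4) +
        {C | M.IsCircuit C ∧ C.ncard = 5}.ncard * 1 ≤
        ((d * d + 6 - 3 * d) / 2) * (p + d - 3).choose 2 + S1.fourCircuitBound d * (p + d - 4) + (d + 4).choose 5 := by
      have := hs5
      gcongr
      omega
    have hsm4q : (({C | M.IsCircuit C ∧ C.ncard = 3}.ncard : ℚ) * ((p + d - 3).choose 2 : ℚ) +
        ({C | M.IsCircuit C ∧ C.ncard = 4}.ncard : ℚ) * ((p + d - 4 : ℕ) : ℚ) +
        ({C | M.IsCircuit C ∧ C.ncard = 5}.ncard : ℚ) * ((1 : ℕ) : ℚ)) ≤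
        ((((d * d + 6 - 3 * d) / 2) * (p + d - 3).choose 2 + S1.fourCircuitBound d * (p + d - 4) +
          (d + 4).choose 5 : ℕ) : ℚ) := by exact_mod_cast hsm4
    have hσ40 : (0 : ℚ) ≤ ∑ j ∈ Finset.range 6, (Nat.choose (min 5 ((d + 3) / 2 + 1 - 2)) j : ℚ) / (((j + 1) + 3 * (j + 1).choose 2 : ℕ) : ℚ) :=
      Finset.sum_nonneg (fun j _ => by positivity)
    refine hD4.trans ?_
    have e1 := mul_le_mul_of_nonneg_left hsm4q hσ40
    linarith
  have h3 : {X : Set α | X ⊆ M.E ∧ M.eRk X = (3 : ℕ)}.ncard ≤ M.E.ncard.choose 3 * 2 ^ (6 - 3) :=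
    S2.ncard_eRk_eq_le_choose_mul_two_pow M 3 6
      (fun X hX hr => ncard_le_six_of_eRk_le_three_of_free M hfree hX (by exact_mod_cast hr))
  have h2 : {X : Set α | X ⊆ M.E ∧ M.eRk X = (2 : ℕ)}.ncard ≤ M.E.ncard.choose 2 * 2 ^ (3 - 2) :=
    S2.ncard_eRk_eq_le_choose_mul_two_pow M 2 3
      (fun X hX hr => by
        have := ncard_add_one_le_two_pow_of_eRk_le M hL0 hfree 2 X hX hr
        omega)
  have h1 : {X : Set α | X ⊆ M.E ∧ M.eRk X = (1 : ℕ)}.ncard ≤ M.E.ncard.choose 1 * 2 ^ (1 - 1) :=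
    S2.ncard_eRk_eq_le_choose_mul_two_pow M 1 1
      (fun X hX hr => by
        have := ncard_add_one_le_two_pow_of_eRk_le M hL0 hfree 1 X hX hr
        omega)
  have h0 : {X : Set α | X ⊆ M.E ∧ M.eRk X = (0 : ℕ)}.ncard ≤ M.E.ncard.choose 0 * 2 ^ (0 - 0) :=
    S2.ncard_eRk_eq_le_choose_mul_two_pow M 0 0
      (fun X hX hr => by
        have := ncard_add_one_le_two_pow_of_eRk_le M hL0 hfree 0 X hX hr
        omega)
  -- the rank-`5` sets have `≤ 5 + d` points (the nullity cap)
  have h5 : {X : Set α | X ⊆ M.E ∧ M.eRk X = 5}.ncard ≤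
      {B : Set α | B ⊆ M.E ∧ M.eRk B = 5 ∧ B.ncard ≤ 5 + d}.ncard := by
    apply Set.ncard_le_ncard
    · intro X hX
      exact ⟨hX.1, hX.2, ncard_le_add_of_eRk_le_of_encard_eq M hd hX.1 (le_of_eq hX.2)⟩
    · exact M.ground_finite.finite_subsets.subset (fun B hB => hB.1)
  have hD0 := S2.ncard_eRk_eq_ncard_le_le_sets M 5 (min 19 (5 + d)) (min 10 (4 + d)) ν₁ 6 (5 + d)
    (by norm_num) hcirc hC1 hflat hflat' (hinter_five M hfree) hd (by omega) (by omega) (by omega)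
  simp only [show (5 : ℕ) + 1 = 6 from rfl] at hD0
  rw [hn, sum_Icc_three_six_q, hm1, hm3, show 5 + d - 6 + 1 = d by omega] at hD0
  simp only [show (6 : ℕ) - 3 = 3 from rfl, show (6 : ℕ) - 4 = 2 from rfl,
    show (6 : ℕ) - 5 = 1 from rfl, show (6 : ℕ) - 6 = 0 from rfl, Nat.choose_one_right,
    Nat.choose_zero_right] at hD0
  have hDq : ({B : Set α | B ⊆ M.E ∧ M.eRk B = 5 ∧ B.ncard ≤ 5 + d}.ncard : ℚ) ≤ ((p + d).choose 5 : ℚ) +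
      (∑ j ∈ Finset.range (d), (Nat.choose (min 13 ((d + 6) / 2 + 1 - 2)) j : ℚ) / (((j + 1) + 3 * (j + 1).choose 2 : ℕ) : ℚ)) *
        ((((d * d + 6 - 3 * d) / 2) * (p + d - 3).choose 3 + S1.fourCircuitBound d * (p + d - 4).choose 2 +
          (d + 4).choose 5 * (p + d - 5) + (d + 5).choose 6 : ℕ) : ℚ) +
      ((∑ j ∈ Finset.range (d), (Nat.choose (min 19 (5 + d) - 6) j : ℚ) / (((j + 1) + 3 * (j + 1).choose 2 : ℕ) : ℚ)) -
        (∑ j ∈ Finset.range (d), (Nat.choose (min 13 ((d + 6) / 2 + 1 - 2)) j : ℚ) / (((j + 1) + 3 * (j + 1).choose 2 : ℕ) : ℚ))) *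
        ((min 19 (5 + d)).choose 6 : ℚ) := by
    have hsm : {C | M.IsCircuit C ∧ C.ncard = 3}.ncard * (p + d - 3).choose 3 +
        {C | M.IsCircuit C ∧ C.ncard = 4}.ncard * (p + d - 4).choose 2 +
        {C | M.IsCircuit C ∧ C.ncard = 5}.ncard * (p + d - 5) + {C | M.IsCircuit C ∧ C.ncard = 6}.ncard * 1 ≤
        ((d * d + 6 - 3 * d) / 2) * (p + d - 3).choose 3 + S1.fourCircuitBound d * (p + d - 4).choose 2 +
          (d + 4).choose 5 * (p + d - 5) + (d + 5).choose 6 := by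
      have := hs6
      gcongr
      omega
    have hsmq : (({C | M.IsCircuit C ∧ C.ncard = 3}.ncard : ℚ) * ((p + d - 3).choose 3 : ℚ) +
        ({C | M.IsCircuit C ∧ C.ncard = 4}.ncard : ℚ) * ((p + d - 4).choose 2 : ℚ) +
        ({C | M.IsCircuit C ∧ C.ncard = 5}.ncard : ℚ) * ((p + d - 5 : ℕ) : ℚ) +
        ({C | M.IsCircuit C ∧ C.ncard = 6}.ncard : ℚ) * ((1 : ℕ) : ℚ)) ≤
        ((((d * d + 6 - 3 * d) / 2) * (p + d - 3).choose 3 + S1.fourCircuitBound d * (p + d - 4).choose 2 +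
          (d + 4).choose 5 * (p + d - 5) + (d + 5).choose 6 : ℕ) : ℚ) := by exact_mod_cast hsm
    have hσm0 : (0 : ℚ) ≤ ∑ j ∈ Finset.range (d), (Nat.choose (min 13 ((d + 6) / 2 + 1 - 2)) j : ℚ) / (((j + 1) + 3 * (j + 1).choose 2 : ℕ) : ℚ) :=
      Finset.sum_nonneg (fun j _ => by positivity)
    refine hD0.trans ?_
    have e1 := mul_le_mul_of_nonneg_left hsmq hσm0
    linarith
  have hB := Matroid.ncard_spanning_le (M := M) hd
  rw [hEcard] at hY hB
  have hΦ := phiK_le_two_pow_div p 5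
  rw [Nat.choose_symm_add] at hΦ
  rw [add_assoc] at hUq
  rw [RLS_iff]
  have hYq : (2 : ℚ) ^ (p + d) ≤ (Matroid.midCount M p 5 : ℚ) +
      ({X : Set α | X ⊆ M.E ∧ M.eRk X ≤ 5}.ncard : ℚ) +
      ({X : Set α | X ⊆ M.E ∧ M.eRk X = M.eRank}.ncard : ℚ) := by exact_mod_cast hY
  have hU0' : (0 : ℚ) ≤ (Matroid.topCount M p 5 : ℚ) := Nat.cast_nonneg _
  -- `#{r ≤ 5} ≤ F₄(n) + count₅` in `ℚ`
  norm_num [Nat.choose_one_right] at h3 h2 h1 h0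
  rw [hn] at h3 h2 h1
  have hAq : ({X : Set α | X ⊆ M.E ∧ M.eRk X ≤ 5}.ncard : ℚ) ≤
      (((p + d).choose 4 : ℚ) +
      (∑ j ∈ Finset.range 6, (Nat.choose (min 5 ((d + 3) / 2 + 1 - 2)) j : ℚ) / (((j + 1) + 3 * (j + 1).choose 2 : ℕ) : ℚ)) *
        ((((d * d + 6 - 3 * d) / 2) * (p + d - 3).choose 2 + S1.fourCircuitBound d * (p + d - 4) + (d + 4).choose 5 : ℕ) : ℚ) +
      ((∑ j ∈ Finset.range 6, (Nat.choose 5 j : ℚ) / (((j + 1) + 3 * (j + 1).choose 2 : ℕ) : ℚ)) -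
        (∑ j ∈ Finset.range 6, (Nat.choose (min 5 ((d + 3) / 2 + 1 - 2)) j : ℚ) / (((j + 1) + 3 * (j + 1).choose 2 : ℕ) : ℚ))) *
        ((10 : ℕ).choose 5 : ℚ)) +
      (((p + d).choose 3 * 2 ^ 3 + (p + d).choose 2 * 2 + (p + d) + 1 : ℕ) : ℚ) +
      (((p + d).choose 5 : ℚ) +
        (∑ j ∈ Finset.range (d), (Nat.choose (min 13 ((d + 6) / 2 + 1 - 2)) j : ℚ) / (((j + 1) + 3 * (j + 1).choose 2 : ℕ) : ℚ)) *
          ((((d * d + 6 - 3 * d) / 2) * (p + d - 3).choose 3 + S1.fourCircuitBound d * (p + d - 4).choose 2 +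
            (d + 4).choose 5 * (p + d - 5) + (d + 5).choose 6 : ℕ) : ℚ) +
        ((∑ j ∈ Finset.range (d), (Nat.choose (min 19 (5 + d) - 6) j : ℚ) / (((j + 1) + 3 * (j + 1).choose 2 : ℕ) : ℚ)) -
          (∑ j ∈ Finset.range (d), (Nat.choose (min 13 ((d + 6) / 2 + 1 - 2)) j : ℚ) / (((j + 1) + 3 * (j + 1).choose 2 : ℕ) : ℚ))) *
        ((min 19 (5 + d)).choose 6 : ℚ)) := by
    have hA4 : {X : Set α | X ⊆ M.E ∧ M.eRk X ≤ 5}.ncard ≤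
        {B : Set α | B ⊆ M.E ∧ M.eRk B = 4 ∧ B.ncard ≤ 10}.ncard +
        ((p + d).choose 3 * 2 ^ 3 + (p + d).choose 2 * 2 + (p + d) + 1) +
        {B : Set α | B ⊆ M.E ∧ M.eRk B = 5 ∧ B.ncard ≤ 5 + d}.ncard := by
      push_cast at hsum5
      omega
    have hA4q : ({X : Set α | X ⊆ M.E ∧ M.eRk X ≤ 5}.ncard : ℚ) ≤
        ({B : Set α | B ⊆ M.E ∧ M.eRk B = 4 ∧ B.ncard ≤ 10}.ncard : ℚ) +
        (((p + d).choose 3 * 2 ^ 3 + (p + d).choose 2 * 2 + (p + d) + 1 : ℕ) : ℚ) +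
        ({B : Set α | B ⊆ M.E ∧ M.eRk B = 5 ∧ B.ncard ≤ 5 + d}.ncard : ℚ) := by exact_mod_cast hA4
    exact hA4q.trans (add_le_add (add_le_add hD4q le_rfl) hDq)
  have hBq : ({X : Set α | X ⊆ M.E ∧ M.eRk X = M.eRank}.ncard : ℚ) ≤
      ((∑ j ∈ Finset.range (d + 1), (p + d).choose j : ℕ) : ℚ) := by exact_mod_cast hB
  obtain ⟨m, hm, hpoly29, htail29⟩ := hcell
  have hABq : (1024 : ℚ) * (({X : Set α | X ⊆ M.E ∧ M.eRk X ≤ 5}.ncard : ℚ) +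
      ({X : Set α | X ⊆ M.E ∧ M.eRk X = M.eRank}.ncard : ℚ)) ≤ (m : ℚ) * 2 ^ (p + d) := by linarith
  rw [add_assoc] at hpoly29
  exact hslack hΦ hU0' hUq hYq hm hABq hpoly29

end ThmN

end PercRepro
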